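import Literature.AlgebraicGeometry.HodgeTheory.ZariskiProjectiveBundleHodgeConjecture
import Literature.AlgebraicGeometry.HodgeTheory.HodgeConjectureDescendsAlongSurjections
import Literature.AlgebraicGeometry.Resolution.ExceptionalDivisorSmoothProjective
import Literature.AlgebraicGeometry.HodgeTheory.HodgeClassesBlowupBirationalInvarianceProofs
import Literature.AlgebraicGeometry.HodgeTheory.ProperModificationCohomologySpanning
import Literature.AlgebraicGeometry.HodgeTheory.ComplexOrientationCycleClassFacts
import Literature.AlgebraicGeometry.HodgeTheory.CurveCorrespondencePushforward
import Literature.AlgebraicGeometry.HodgeTheory.CorrespondenceSupportedVanishing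
import Literature.AlgebraicGeometry.Resolution.BirationalDimensionReduced
import HarnessLib

/-!
# The Hodge conjecture is stable under smooth blow-ups (Murre 1977 Lemma 2 / Arapura 2001 Lemma 16),
# granted only the pull-back of algebraic classes; hence, on the same footing, the Hodge conjecture is a
# birational invariant of smooth projective complex varieties of dimension `≤ 5` (Arapura 2001 Cor. 17)

Topic `Literature/AlgebraicGeometry/HodgeTheory`. PROVED over the tree modulo ONE named fact of the tree:
this file reduces the named fact `Arapura2001_hodgeClasses_algebraic_smoothBlowup` of
`HodgeClassesBlowupBirationalInvariance` (`HC(X) ∧ HC(Z) ⇒ HC(Bl_Z X)` for a smooth blow-up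
`IsSmoothBlowupAlong n k X Z X' i b`) to the named fact `fulton1998_map_mem_algebraicClasses` of
`AlgebraicClassesPullback` (pull-back along a `ℂ`-morphism of smooth projective varieties preserves
`Nᵖ H²ᵖ`, Fulton Cor. 19.2 (b)) — `Arapura2001_hodgeClasses_algebraic_smoothBlowup_of_pullbackAlgebraic` —
using otherwise theorems of the tree only:

* the spanning half of the blow-up formula `H*(X') = b^* H*(X) + j_* H*(E)`
  (`mem_range_map_sup_iSup_range_complexGysin_of_isIso_restrict`, Voisin I Thm. 7.31);
* the exceptional divisor `E = X' ×_X Z → Z` is a smooth projective Zariski `ℙʳ`-bundle over `Z`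
  (`Resolution.isSmoothProjective_exceptionalDivisor`, `Resolution.isZariskiProjectiveBundle_exceptionalDivisor`,
  Hartshorne II 8.24 (b));
* `HC` ascends along Zariski `ℙʳ`-bundles (`ZariskiProjectiveBundle.hodgeConjectureFor_projectiveBundle`,
  Leray–Hirsch, Voisin I Lemma 7.32 — fact-free);
* Hodge classes lift along the jointly surjective rational Hodge maps `b^*` (bidegree `(0,0)`) and `j_*`
  (bidegree `(1,1)`) (`exists_isRationalClass_isOfHodgeType_eq_sum`, Voisin 2025 Cor. 2.12);
* `j_*` preserves algebraic classes (`complexGysin_mem_algebraicClasses_of_mem_algebraicClasses`); `b^*` does by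
  the HYPOTHESIS `hF : fulton1998_map_mem_algebraicClasses` (the blow-down `b` is not flat, so the tree's
  `map_mem_algebraicClasses_of_flat` does not apply).

The pull-back fact is itself PROVED in the tree, but Summits-side (crux `PullbackAlgebraic`,
stmt-HodgeConjecture-1071, deformation to the normal cone:
`Summit.HodgeConjecture.HodgeConjecture.Theorems.fulton1998_map_mem_algebraicClasses_holds` in
`Summits/HodgeConjecture/HodgeConjecture/Theorems/BoundaryReadoutPullbackAlgebraic.lean`), which a
`Literature/` file may not import; so the unconditional discharge is the one-line Summits-side term
`Arapura2001_hodgeClasses_algebraic_smoothBlowup_of_pullbackAlgebraic fulton1998_map_mem_algebraicClasses_holds`.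
The degenerate datum `dim Z = dim X` is contradictory (the centre would be all of `X`, `ker i = ⊥`, and a
blow-up along the zero ideal is empty), so the reduction covers the fact in full. CONSEQUENCES on the same
footing (feeding the reduction to the consumers of `HodgeClassesBlowupBirationalInvarianceProofs`, where
Hironaka's domination is already a theorem): **granted `hF`, the Hodge conjecture is a birational invariant
among smooth projective complex `n`-folds, `n ≤ 5`** (`hodgeBirationalInvariant_le_five`, Arapura 2001
Cor. 17), in every dimension modulo HC for the possible centres (`hodgeBirationalInvariant_of_lowDim_centres`),
it transfers along birational morphisms and up smooth blow-up towers in dimension `≤ 5`, and every smooth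
projective variety of dimension `≤ 5` dominated through a smooth roof `ℙⁿ ← W → Y` (e.g. the unirational
ones with such a roof) satisfies it (`hodgeConjectureFor_of_roof_projectiveSpace_of_le_five`, Murre 1977).

Provenance: cell `pub/hodge-nonav`, chapter ROUTE-P1R «BLF» (planner seat p1 g19–g20: cell sketch
`ROUTE-P1R-Sketch-BL.lean` v2 fc64282de72b1099, refereed PASS by the cell referee g33), promoted to
`Literature/` by the cell's literature seat together with the Literature homes of its two Summits-only
inputs (`Resolution/ExceptionalDivisorSmoothProjective`, `HodgeTheory/ZariskiProjectiveBundleLerayHirsch`).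
§CL⁺ (appended): with the tree's descent of HC along surjective morphisms of ANY relative dimension
(`SurjectiveDescent.hodgeConjectureFor_of_surjective`, `HodgeConjectureDescendsAlongSurjections`), HC passes from a
smooth projective `n`-fold `X`, `n ≤ 5` (granted `hF`), to every smooth projective variety `Y` (any dimension) onto
which the top of a smooth blow-up tower over `X` maps — the resolved form of "HC descends along dominant rational
maps out of dimension `≤ 5`" (Arapura 2001 Lemma 13 + Lemma 16 + Hironaka).

## References

* [Murre1977] J. P. Murre, On the Hodge conjecture for unirational fourfolds, Indag. Math. 39 (1977),
  Lemma 2 (p. 231), Theorem (p. 232).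
* [Arapura2001HodgeCyclesModuli] D. Arapura, Motivation for Hodge cycles, Lemma 13, Lemma 16, Cor. 17,
  Lemma 18.
* [VoisinHodgeI2002] C. Voisin, Hodge Theory and Complex Algebraic Geometry I, §7.3.3 Thm. 7.31, Lemma 7.32.
* [Voisin2025] C. Voisin, Cor. 2.12 (Hodge-class lift along jointly surjective rational Hodge maps), as
  cited by the tree's `HodgeClassLiftRationalHodgeMaps`.
* [Hartshorne1977] R. Hartshorne, Algebraic Geometry, II Thm. 8.24, I Prop. 1.10, II Ex. 3.20.
* [GortzWedhorn2020] U. Görtz, T. Wedhorn, Algebraic Geometry I, Def. 13.90 (blow-ups).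
-/

noncomputable section

open CategoryTheory CategoryTheory.Limits AlgebraicGeometry MonoidalCategory CartesianMonoidalCategory
  Literature.AlgebraicGeometry Literature.AlgebraicGeometry.Motives
  Literature.AlgebraicGeometry.HodgeTheory Literature.AlgebraicGeometry.Resolution TopologicalSpace
open Literature.AlgebraicTopology.SingularHomology
open Literature.AlgebraicTopology.CharacteristicClasses (cupPow cupPow_zero cupPow_succ)
open scoped Manifold

namespace Literature.AlgebraicGeometry.HodgeTheory

/-! ## §V Hodge classes lift along TWO rational Hodge-linear maps (Voisin 2025 Cor. 2.12, `ι = Bool`) -/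

/-- Two-map form of `exists_isRationalClass_isOfHodgeType_eq_sum`: a rational `(q,q)`-class in
`im G₁ + im G₂`, `Gᵢ : H^{2dᵢ}(Yᵢ) → H^{2q}(X)` rational Hodge-linear of bidegree `(eᵢ, eᵢ)`, is
`G₁ a₁ + G₂ a₂` with `aᵢ` rational of type `(dᵢ, dᵢ)`. [cite: Voisin2025, Cor. 2.12] -/
theorem exists_isRationalClass_isOfHodgeType_eq_add {n m₁ m₂ : ℕ} {X Y₁ Y₂ : SchemeOver ℂ}
    (hX : IsSmoothProjective n X) (hY₁ : IsSmoothProjective m₁ Y₁) (hY₂ : IsSmoothProjective m₂ Y₂)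
    (q d₁ e₁ d₂ e₂ : ℕ) (h₁ : d₁ + e₁ = q) (h₂ : d₂ + e₂ = q)
    (G₁ : complexBetti Y₁ (2 * d₁) →ₗ[ℂ] complexBetti X (2 * q))
    (G₂ : complexBetti Y₂ (2 * d₂) →ₗ[ℂ] complexBetti X (2 * q))
    (hG₁rat : ∀ y, IsRationalClass y → IsRationalClass (G₁ y))
    (hG₁typ : ∀ ⦃a b : ℕ⦄ ⦃y⦄, a + b = 2 * d₁ → IsOfHodgeType m₁ Y₁ (2 * d₁) a b y →
      IsOfHodgeType n X (2 * q) (a + e₁) (b + e₁) (G₁ y))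
    (hG₂rat : ∀ y, IsRationalClass y → IsRationalClass (G₂ y))
    (hG₂typ : ∀ ⦃a b : ℕ⦄ ⦃y⦄, a + b = 2 * d₂ → IsOfHodgeType m₂ Y₂ (2 * d₂) a b y →
      IsOfHodgeType n X (2 * q) (a + e₂) (b + e₂) (G₂ y))
    {c : complexBetti X (2 * q)} (hc : IsRationalClass c) (hc' : IsOfHodgeType n X (2 * q) q q c)
    (hcg : c ∈ LinearMap.range G₁ ⊔ LinearMap.range G₂) :
    ∃ (a₁ : complexBetti Y₁ (2 * d₁)) (a₂ : complexBetti Y₂ (2 * d₂)),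
      (IsRationalClass a₁ ∧ IsOfHodgeType m₁ Y₁ (2 * d₁) d₁ d₁ a₁) ∧
      (IsRationalClass a₂ ∧ IsOfHodgeType m₂ Y₂ (2 * d₂) d₂ d₂ a₂) ∧ c = G₁ a₁ + G₂ a₂ := by
  obtain ⟨a, ha, hsum⟩ := exists_isRationalClass_isOfHodgeType_eq_sum hX (ι := Bool)
    (m := fun t ↦ bif t then m₁ else m₂) (d := fun t ↦ bif t then d₁ else d₂)
    (Y := fun t ↦ bif t then Y₁ else Y₂) (fun t ↦ by cases t; exacts [hY₂, hY₁]) q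
    (fun t ↦ bif t then e₁ else e₂) (fun t ↦ by cases t; exacts [h₂, h₁])
    (fun t ↦ match t with | true => G₁ | false => G₂)
    (fun t ↦ by cases t; exacts [hG₂rat, hG₁rat])
    (fun t ↦ by cases t; exacts [hG₂typ, hG₁typ]) hc hc'
    (by rw [iSup_bool_eq]; exact hcg)
  exact ⟨a true, a false, ha true, ha false, by rw [hsum, Fintype.sum_bool]; rfl⟩

/-! ## §D The degenerate datum: a smooth blow-up has a centre of smaller dimension -/

/-- A blow-up along the zero ideal sheaf is empty: the exceptional Cartier divisor would be cut
out, near any point, by the regular element `0`. [cite: GortzWedhorn2020, Def. 13.90 and Prop. 13.91] -/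
theorem isEmpty_of_isBlowup_bot {X' X : Scheme.{0}} {π : X' ⟶ X}
    (h : IsBlowup π (⊥ : X.IdealSheafData)) : IsEmpty X' := by
  refine ⟨fun x ↦ ?_⟩
  obtain ⟨U, hxU, f, hf, hfI⟩ := h.isEffectiveCartier x
  rw [(Scheme.IdealSheafData.map_gc π).l_bot, Scheme.IdealSheafData.ideal_bot] at hfI
  have hf0 : f = 0 := by
    have hmem : f ∈ Ideal.span {f} := Ideal.mem_span_singleton_self f
    rw [← hfI] at hmem
    exact hmem
  rw [hf0] at hf
  haveI : Subsingleton Γ(X', U) := not_nontrivial_iff_subsingleton.1 fun hnt ↦ by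
    haveI := hnt
    exact zero_notMem_nonZeroDivisors hf
  have h01 : (0 : X'.presheaf.stalk x) = 1 := by
    rw [← map_one (X'.presheaf.germ U x hxU).hom, Subsingleton.elim (1 : Γ(X', U)) 0, map_zero]
  exact zero_ne_one h01

/-- **The centre of a smooth blow-up has dimension `< dim X`.** If `i(Z) = X` then (`X` reduced)
`i` is an isomorphism, `ker i = ⊥`, and the blow-up `X'` is empty, contradicting its irreducibility;
otherwise `i(Z) ⊊ X` is a closed nowhere dense subset of the irreducible Noetherian `X`, of dimension
`dim Z = k`, and the dimension drops (`topologicalKrullDim_lt_of_isClosed_of_dense_compl`).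
[cite: Hartshorne1977, I Prop. 1.10 and II Ex. 3.20] -/
theorem dim_lt_of_isSmoothBlowupAlong {n k : ℕ} {X Z X' : SchemeOver ℂ} {i : Z ⟶ X} {b : X' ⟶ X}
    (h : IsSmoothBlowupAlong n k X Z X' i b) : k < n := by
  obtain ⟨hX, hZ, hX', hi, hb⟩ := h
  haveI := hi
  haveI := hX.smoothOfRelativeDimension
  haveI := hZ.smoothOfRelativeDimension
  haveI : IsIntegral X.left := IsSmoothProjective.isIntegral_holds hX
  haveI : IsIntegral Z.left := IsSmoothProjective.isIntegral_holds hZ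
  haveI : IsIntegral X'.left := IsSmoothProjective.isIntegral_holds hX'
  -- the centre is a proper closed subset
  have hne : Set.range i.left.base ≠ Set.univ := by
    intro huniv
    haveI : Surjective i.left := ⟨Set.range_eq_univ.1 huniv⟩
    haveI : IsIso i.left := isIso_of_isClosedImmersion_of_surjective i.left
    have hker : i.left.ker = ⊥ := i.left.ker_eq_bot_of_isIso
    rw [hker] at hb
    exact (isEmpty_of_isBlowup_bot hb).false (Classical.arbitrary X'.left)
  -- dimension drop along the closed nowhere dense `i(Z)`
  haveI := noetherianSpace_of_isSmoothProjective hX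
  have hdimX : topologicalKrullDim X.left = n :=
    topologicalKrullDim_eq_of_smoothOfRelativeDimension (f := X.hom) (n := n)
  have hdimZ : topologicalKrullDim Z.left = k :=
    topologicalKrullDim_eq_of_smoothOfRelativeDimension (f := Z.hom) (n := k)
  have hclosed : IsClosed (Set.range i.left.base) := i.left.isClosedEmbedding.isClosed_range
  have hdense : Dense (Set.range i.left.base)ᶜ :=
    hclosed.isOpen_compl.dense (Set.nonempty_compl.2 hne)
  have hlt := topologicalKrullDim_lt_of_isClosed_of_dense_compl hclosed hdense n
    (by rw [hdimX]; exact_mod_cast Nat.lt_succ_self n)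
  rw [← IsHomeomorph.topologicalKrullDim_eq _
      i.left.isClosedEmbedding.isEmbedding.toHomeomorph.isHomeomorph, hdimZ] at hlt
  exact_mod_cast hlt

/-! ## §B The blow-up closure (Murre 1977 Lemma 2 / Arapura 2001 Lemma 16), modulo the pull-back fact -/

/-- **`HC(X) ∧ HC(Z) ⇒ HC(Bl_Z X)` for a smooth blow-up with `dim Z < dim X`.** Write `n = k + r + 1`.
The exceptional divisor `E = X' ×_X Z` is smooth projective of dimension `k + r` and a Zariski
`ℙʳ`-bundle over `Z`, so `HC(E)` (`hodgeConjectureFor_projectiveBundle`); `H^{2p}(X')` is spanned by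
`b^* H^{2p}(X)` and `j_* H^{2p-2}(E)` (spanning half of Voisin I Thm. 7.31), two rational Hodge-linear
maps of bidegrees `(0,0)` and `(1,1)`, so a rational `(p,p)`-class is `b^* y + j_* e` with `y`, `e`
rational of types `(p,p)`, `(p-1,p-1)` (Voisin 2025 Cor. 2.12), hence algebraic, and `b^*` (hypothesis
`hF`, the pull-back fact), `j_*` preserve algebraic classes. [cite: VoisinHodgeI2002, §7.3.3 Thm. 7.31] [cite: Murre1977, Lemma 2]
[cite: Arapura2001HodgeCyclesModuli, Lemma 16] [cite: Voisin2025, Cor. 2.12] -/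
theorem hodgeConjectureFor_smoothBlowup_of_lt (hF : fulton1998_map_mem_algebraicClasses)
    {n k : ℕ} {X Z X' : SchemeOver ℂ} {i : Z ⟶ X}
    {b : X' ⟶ X} (h : IsSmoothBlowupAlong n k X Z X' i b) (hkn : k < n)
    (hXHC : HodgeConjectureFor n X) (hZHC : HodgeConjectureFor k Z) : HodgeConjectureFor n X' := by
  classical
  obtain ⟨hX, hZ, hX', hi, hb⟩ := h
  haveI := hi
  obtain ⟨r, rfl⟩ : ∃ r, n = k + r + 1 := ⟨n - k - 1, by omega⟩
  haveI : IsIntegral X.left := IsSmoothProjective.isIntegral_holds hX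
  -- the exceptional divisor `E = X' ×_X Z → Z`, a Zariski-locally trivial `ℙʳ`-bundle
  let E : SchemeOver ℂ := Over.mk (pullback.snd b.left i.left ≫ Z.hom)
  have hE : IsSmoothProjective (k + r) E :=
    isSmoothProjective_exceptionalDivisor i b hX hZ hi hb
  let q : E ⟶ Z := Over.homMk (pullback.snd b.left i.left) rfl
  have htriv : IsZariskiProjectiveBundle r q :=
    isZariskiProjectiveBundle_exceptionalDivisor (k := ℂ) i b hX hZ hi hb
  have hEHC : HodgeConjectureFor (k + r) E :=
    ZariskiProjectiveBundle.hodgeConjectureFor_projectiveBundle q hZ hE htriv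
      (cupPreservesHodgeType_of_hodgeModel hE (Classical.choice (nonempty_hodgeModel_holds hE))) hZHC
  -- the closed immersion `j : E ⟶ X'`
  let j : E ⟶ X' := Over.homMk (pullback.fst b.left i.left) (by
    change pullback.fst b.left i.left ≫ X'.hom = pullback.snd b.left i.left ≫ Z.hom
    rw [← Over.w b, pullback.condition_assoc, Over.w i])
  haveI hj : IsClosedImmersion j.left :=
    inferInstanceAs (IsClosedImmersion (pullback.fst b.left i.left))
  -- `b` is birational and an isomorphism off the centre `i(Z) = supp (ker i)`
  have hker : i.left.ker ≠ ⊥ :=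
    ker_ne_bot_of_range_ne_univ i.left
      (range_ne_univ_of_isSmoothProjective_of_ne i hZ hX (by omega))
  have hbir : Resolution.IsBirational b.left := hb.isBirational' hker
  let U : X.left.Opens := ⟨(i.left.ker.support : Set X.left)ᶜ, i.left.ker.support.isClosed.isOpen_compl⟩
  haveI : IsIso (b.left ∣_ U) := hb.isIso_compl
  have hcov : ((b.left ⁻¹ᵁ U : Set X'.left))ᶜ = ⋃ _ : Unit, Set.range j.left.base := by
    rw [Set.iUnion_const]
    change (b.left.base ⁻¹' ((i.left.ker.support : Set X.left)ᶜ))ᶜ =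
      Set.range (pullback.fst b.left i.left).base
    rw [Set.preimage_compl, compl_compl, Scheme.Pullback.range_fst, Scheme.Hom.support_ker,
      i.left.isClosedEmbedding.isClosed_range.closure_eq]
  refine ⟨nonempty_hodgeModel_holds hX', fun p c hc hpp ↦ ?_⟩
  cases p with
  | zero => exact hodgeConjectureFor_codim_zero c
  | succ p₀ =>
  -- the spanning half of the blow-up formula: `c ∈ b^* H(X) + j_* H(E)`
  have hspan := mem_range_map_sup_iSup_range_complexGysin_of_isIso_restrict complexOrientationFamily
    hX' hX b hbir U (ι := Unit) (m := fun _ ↦ k + r) (E := fun _ ↦ E) (fun _ ↦ hE) (fun _ ↦ j)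
    Subsingleton.pairwise hcov (2 * (p₀ + 1)) c
  have hab : 2 * p₀ + 2 * (k + r + 1) = 2 * (p₀ + 1) + 2 * (k + r) := by ring
  have hcg : c ∈ LinearMap.range (complexBetti.map b (2 * (p₀ + 1))).hom ⊔
      LinearMap.range (complexGysin complexOrientationFamily hE hX' j hab) := by
    refine (SetLike.le_def.1 (sup_le_sup_left ?_ _)) hspan
    refine iSup_le fun _ ↦ iSup_le fun a ↦ iSup_le fun hab' ↦ ?_
    obtain rfl : a = 2 * p₀ := by omega
    exact le_rfl
  -- Hodge classes lift along the two rational Hodge maps `b^*` (bidegree `(0,0)`), `j_*` (`(1,1)`)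
  obtain ⟨y, e, ⟨hyrat, hytyp⟩, ⟨herat, hetyp⟩, hsum⟩ :=
    exists_isRationalClass_isOfHodgeType_eq_add hX' hX hE (p₀ + 1) (p₀ + 1) 0 p₀ 1 rfl rfl
      (complexBetti.map b (2 * (p₀ + 1))).hom (complexGysin complexOrientationFamily hE hX' j hab)
      (fun y hy ↦ hy.map (Motives.AlgPoints.mapContinuous (L := ℂ) b))
      (fun a' b' y _ hy ↦ hy.map_of_isSmoothProjective hX' hX b)
      (fun e he ↦ isRationalClass_complexGysin_complexOrientationFamily hE hX' j hab he)
      (fun a' b' e _ he ↦ isOfHodgeType_complexGysin hodgePQ_independent_of_hodgeModel_holds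
        (fun m Y ↦ nonempty_hodgeModel_holds)
        (fun F _ _ _ ↦ Literature.NumberTheory.Transcendental.exists_deRhamIsoFamily_holds F)
        complexOrientationFamily hE hX' j hab (p' := a' + 1) (q' := b' + 1) (by omega) (by omega) he)
      hc hpp hcg
  rw [hsum]
  refine Submodule.add_mem _ ?_ ?_
  · exact hF b hX hX' (p₀ + 1) y (hXHC.2 _ y hyrat hytyp)
  · exact complexGysin_mem_algebraicClasses_of_mem_algebraicClasses complexOrientationFamily hE hX' j
      hab (hEHC.2 p₀ e herat hetyp)

/-! ## §F The named fact reduced to the pull-back fact; the tree's consumers on the same footing -/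

/-- **Murre 1977 Lemma 2 / Arapura 2001 Lemma 16 — the tree's named fact
`Arapura2001_hodgeClasses_algebraic_smoothBlowup` follows from the pull-back fact
`fulton1998_map_mem_algebraicClasses`** (Fulton Cor. 19.2 (b); proved Summits-side as
`Summit.HodgeConjecture.HodgeConjecture.Theorems.fulton1998_map_mem_algebraicClasses_holds`, so the
unconditional discharge is this theorem applied to that one). Relies on: `hF` only.
[cite: Murre1977, Lemma 2 (p. 231)] [cite: Arapura2001HodgeCyclesModuli, Lemma 16]
[cite: VoisinHodgeI2002, §7.3.3 Thm. 7.31] -/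
theorem Arapura2001_hodgeClasses_algebraic_smoothBlowup_of_pullbackAlgebraic
    (hF : fulton1998_map_mem_algebraicClasses) : Arapura2001_hodgeClasses_algebraic_smoothBlowup :=
  fun _ _ _ _ _ _ _ h hX hZ ↦ hodgeConjectureFor_smoothBlowup_of_lt hF h (dim_lt_of_isSmoothBlowupAlong h) hX hZ

variable {n : ℕ}

/-- **Arapura 2001 Cor. 17, granted the pull-back fact: the Hodge conjecture is a birational invariant of
smooth projective complex `n`-folds, `n ≤ 5`.** [cite: Arapura2001HodgeCyclesModuli, Cor. 17] -/
theorem hodgeBirationalInvariant_le_five (hF : fulton1998_map_mem_algebraicClasses) (hn : n ≤ 5) :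
    HodgeBirationalInvariant n :=
  hodgeBirationalInvariant_of_le_five' (Arapura2001_hodgeClasses_algebraic_smoothBlowup_of_pullbackAlgebraic hF) hn

/-- **Birational invariance in any dimension `n`, granted the pull-back fact and HC for all smooth
projective varieties of dimension `≤ n - 2`.** [cite: Arapura2001HodgeCyclesModuli, Lemma 16 and proof of Cor. 17] -/
theorem hodgeBirationalInvariant_of_lowDim_centres (hF : fulton1998_map_mem_algebraicClasses)
    (hlow : ∀ ⦃k : ℕ⦄ ⦃Z : SchemeOver ℂ⦄, k + 2 ≤ n → IsSmoothProjective k Z → HodgeConjectureFor k Z) :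
    HodgeBirationalInvariant n :=
  hodgeBirationalInvariant_of_centres' (Arapura2001_hodgeClasses_algebraic_smoothBlowup_of_pullbackAlgebraic hF) hlow

/-- **HC transfers along a birational morphism of smooth projective `n`-folds, `n ≤ 5`** (granted the
pull-back fact). [cite: Arapura2001HodgeCyclesModuli, Cor. 17] -/
theorem HodgeConjectureFor.of_isBirational_le_five (hF : fulton1998_map_mem_algebraicClasses) (hn : n ≤ 5)
    {X X'' : SchemeOver ℂ}
    (hX : IsSmoothProjective n X) (hX'' : IsSmoothProjective n X'') (p : X'' ⟶ X)
    (hp : IsBirational p.left) (h : HodgeConjectureFor n X) : HodgeConjectureFor n X'' :=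
  Literature.AlgebraicGeometry.HodgeTheory.hodgeConjectureFor_of_isBirational_of_le_five
    (Arapura2001_hodgeClasses_algebraic_smoothBlowup_of_pullbackAlgebraic hF) hn hX hX'' p hp h

/-- **Murre 1977 / Arapura 2001 Lemma 18, granted the pull-back fact: a smooth projective variety of dimension
`≤ 5` rationally dominated by `ℙⁿ` through a smooth roof `ℙⁿ ← W → Y` (e.g. every UNIRATIONAL smooth
projective variety of dimension `≤ 5` admitting such a roof) satisfies the Hodge conjecture.**
[cite: Murre1977, Theorem (p. 232)] [cite: Arapura2001HodgeCyclesModuli, Lemma 18 and Cor. 17] -/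
theorem hodgeConjectureFor_of_roof_projectiveSpace_of_le_five (hF : fulton1998_map_mem_algebraicClasses)
    (hn : n ≤ 5) {W Y : SchemeOver ℂ}
    (hW : IsSmoothProjective n W) (hY : IsSmoothProjective n Y) (p : W ⟶ projectiveSpace n ℂ)
    (hp : IsBirational p.left) (q : W ⟶ Y) [Surjective q.left] : HodgeConjectureFor n Y :=
  Literature.AlgebraicGeometry.HodgeTheory.hodgeConjectureFor_of_roof_projectiveSpace_le_five
    (Arapura2001_hodgeClasses_algebraic_smoothBlowup_of_pullbackAlgebraic hF) hn hW hY p hp q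

/-- **HC climbs smooth blow-up towers on `n`-folds, `n ≤ 5`** (granted the pull-back fact). [cite: Murre1977, proof of the Theorem (p. 232)] [cite: Arapura2001HodgeCyclesModuli, Cor. 17] -/
theorem hodgeConjectureFor_of_smoothBlowupTower_le_five (hF : fulton1998_map_mem_algebraicClasses)
    (hn : n ≤ 5) {X X'' : SchemeOver ℂ}
    (ht : Relation.ReflTransGen (SmoothBlowupStep n) X X'') (h : HodgeConjectureFor n X) :
    HodgeConjectureFor n X'' :=
  (Arapura2001_hodgeClasses_algebraic_smoothBlowup_of_pullbackAlgebraic hF).of_reflTransGen_smoothBlowupStep hn ht h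


/-! ## §CL⁺ HC descends along dominant rational maps out of dimension `≤ 5`, resolved form: `Y` the surjective image
of the top of a smooth blow-up tower over `X` (any target dimension) -/

/-- **Arapura 2001 Lemma 13 + Lemma 16 + Hironaka, for `n ≤ 5` (granted the pull-back fact): if the smooth
projective `m`-fold `Y` (any `m`) is the surjective image of the top `X₃` of a smooth blow-up tower over the smooth
projective `n`-fold `X`, `n ≤ 5`, and `HC(X)`, then `HC(Y)`** — subsumes birational invariance, unirational images
and finite quotients with a smooth projective model. [cite: Arapura2001HodgeCyclesModuli, Lemma 13, Lemma 16 and Cor. 17]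
[cite: Murre1977, Theorem (p. 232)] [cite: Arapura2006, §1 Cor. 1.2] -/
theorem hodgeConjectureFor_of_tower_surjective_le_five (hF : fulton1998_map_mem_algebraicClasses) (hn : n ≤ 5)
    {m : ℕ} {X X₃ Y : SchemeOver ℂ} (ht : Relation.ReflTransGen (SmoothBlowupStep n) X X₃)
    (hX₃ : IsSmoothProjective n X₃) (hY : IsSmoothProjective m Y) (r : X₃ ⟶ Y) [Surjective r.left]
    (h : HodgeConjectureFor n X) : HodgeConjectureFor m Y :=
  SurjectiveDescent.hodgeConjectureFor_of_surjective hX₃ hY r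
    (hodgeConjectureFor_of_smoothBlowupTower_le_five hF hn ht h)

/-- **The same in every dimension `n`, granted the pull-back fact and HC for all smooth projective varieties of
dimension `≤ n - 2` (the centres of the tower).** [cite: Arapura2001HodgeCyclesModuli, Lemma 13 and Lemma 16]
[cite: Arapura2006, §1 Cor. 1.2] -/
theorem hodgeConjectureFor_of_tower_surjective_of_lowDim_centres (hF : fulton1998_map_mem_algebraicClasses)
    {m : ℕ} {X X₃ Y : SchemeOver ℂ}
    (hlow : ∀ ⦃k : ℕ⦄ ⦃Z : SchemeOver ℂ⦄, k + 2 ≤ n → IsSmoothProjective k Z → HodgeConjectureFor k Z)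
    (ht : Relation.ReflTransGen (SmoothBlowupStep n) X X₃) (hX₃ : IsSmoothProjective n X₃)
    (hY : IsSmoothProjective m Y) (r : X₃ ⟶ Y) [Surjective r.left] (h : HodgeConjectureFor n X) :
    HodgeConjectureFor m Y :=
  SurjectiveDescent.hodgeConjectureFor_of_surjective hX₃ hY r
    ((Arapura2001_hodgeClasses_algebraic_smoothBlowup_of_pullbackAlgebraic hF).of_reflTransGen_smoothBlowupStep_of_centres
      hlow ht h)

end Literature.AlgebraicGeometry.HodgeTheory

end
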